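import Literature.Probability.Percolation.SlabRSWGluingLinear
import Literature.Probability.Percolation.SlabRSWGluingCoreB
import HarnessLib

/-!
# Newman–Tassion–Wu 2017, §3.2 — the linear gluing bound from an abstract supply of local modifications

Topic: `Literature/Probability/Percolation`. `SlabRSWGluingLinear.lean` proves the linear regime of
NTW's gluing lemma (Thm. 3.7, second part: `P[𝒳] ≤ C₃ P[𝒳′]`; Thm. 3.6) for one geometry (a
rectangle with the target set `B` a full side), with the three local modifications constructed in
`SlabRSWGluingGeometry.lean`. The probabilistic argument — Lemma 3.5 (`lemma7_bond`) applied to a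
map changing boundedly many edges in a window that is read off the image through a recovery
statistic — does not depend on the geometry. This file isolates it:

* `GadgetSpec Q k r ω ω'` — what a local modification `ω ↦ ω'` must provide: `ω' ∈ {C ⟷^R A}`;
  `ω' ⊆ ω ∪ {lattice edges inside R̄}`; and a cleared set `D` inside some box of radius `r`, outside
  of whose columns `ω` and `ω'` agree, which contains one of the three recovery statistics of `ω'`
  (`att`, `attT(C → A)`, `attT(A → C)`), that statistic being non-empty.
* `real_evXn_le_of_gadgets` — PROVED: if every lattice configuration of `𝒳` has such a
  modification, then `P_p[𝒳] ≤ λ^s · P_p[C ⟷^R A]`, `λ = 2/min{p,1-p}`, `s = 3(5k+4)(4r+1)²`.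
* `real_evAB_inter_evNear_le_of_gadgets`, `glueLinear_of_gadgets` — PROVED: the same followed by
  `{A ⟷ B} ∩ {C̄ ⟷ 𝒩(Γ̄, ρ)} ⊆ 𝒳 ∪ {C ⟷ A}` and, under the planar-crossing hypothesis with
  `R = S`, Harris–FKG: `P[A ⟷^S B] P[C ⟷^S D] ≤ (1 + λ^s) P[C ⟷^S A]`.
* The four kinds of modifications of this port all provide a `GadgetSpec`
  (`GadgetSpec.of_surgery`, `of_surgeryB`, `of_directGlue_A`, `of_directGlue_C`).

## Sources

* C. M. Newman, V. Tassion, W. Wu, *Critical percolation and the minimal spanning tree in slabs*,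
  Comm. Pure Appl. Math. 70 (2017), arXiv:1512.09107: §3.2, Lemma 3.5, proof of Theorem 3.7,
  second part ("we can construct a map `Φ : 𝒳 → 𝔓(𝒳′)` … the number of edges … that can vary is
  bounded, this gives `P[𝒳] ≤ C₃ P[𝒳′]`", p. 10), proof of Theorem 3.6 [NewmanTassionWu2017].
-/

noncomputable section

namespace Literature.Probability.Percolation

open MeasureTheory LatticeModels SimpleGraph Finset

namespace NTW17

variable {k : ℕ}

/-! ## The interface of a local modification -/

/-- **What the linear bound needs from a local modification `ω ↦ ω'`** (NTW, proof of Thm. 3.7,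
second part): the image glues `C` to `A` inside `R̄`; it consists of old edges and lattice edges
inside `R̄`; and there is a cleared set `D`, inside a box of radius `r`, outside of whose columns
`ω` and `ω'` agree and over which one of the three recovery statistics of `ω'` lies, non-empty.
[cite: NewmanTassionWu2017, §3.2 (proof of Theorem 3.7, second part)] -/
structure GadgetSpec (Q : GlueData) (k r : ℕ) (ω ω' : BondConfig (slab 3 k)) : Prop where
  /-- the image glues `C` to `A` -/
  mem : ω' ∈ Q.evCA k
  /-- the image stays in the window -/
  window : ∀ e ∈ ω', e ∈ ω ∨ (e ∈ (slabGraph 3 k).edgeSet ∧ e ∈ (slabLift k Q.R).sym2)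
  /-- the modification is local and recoverable -/
  recover : ∃ D : Set (ℤ × ℤ), (∀ e, e ∉ touch k D → (e ∈ ω ↔ e ∈ ω')) ∧
    (∃ z : ℤ × ℤ, D ⊆ sqBox z r) ∧
    (((Q.att k ω').Nonempty ∧ Q.att k ω' ⊆ slabLift k D) ∨
      ((attT k Q.R Q.C Q.A ω').Nonempty ∧ attT k Q.R Q.C Q.A ω' ⊆ slabLift k D) ∨
      ((attT k Q.R Q.A Q.C ω').Nonempty ∧ attT k Q.R Q.A Q.C ω' ⊆ slabLift k D))

namespace GadgetSpec

variable {Q : GlueData} {ω : BondConfig (slab 3 k)} {r : ℕ}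

/-- A rerouting surgery with a small cleared set is a gadget. [cite: NewmanTassionWu2017, §3.2 (proof of Theorem 3.7)] -/
theorem of_surgery (hX : ω ∈ Q.evX k) (sx : Q.Surgery k ω) (hz : ∃ z : ℤ × ℤ, sx.D ⊆ sqBox z r) :
    GadgetSpec Q k r ω sx.newConfig :=
  ⟨sx.newConfig_mem_evCA hX, fun _ he => sx.mem_window hX.1 he,
    ⟨sx.D, fun _ he => sx.agree_off_touch he, hz, Or.inl ⟨sx.att_nonempty hX, sx.att_subset hX⟩⟩⟩

/-- A surgery ending in `B̄` with a small cleared set is a gadget. [cite: NewmanTassionWu2017, §3.2 (proof of Theorem 3.7)] -/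
theorem of_surgeryB (hX : ω ∈ Q.evX k) (sb : Q.SurgeryB k ω) (hz : ∃ z : ℤ × ℤ, sb.D ⊆ sqBox z r) :
    GadgetSpec Q k r ω sb.newConfig :=
  ⟨sb.newConfig_mem_evCA hX, fun _ he => sb.mem_window hX.1 he,
    ⟨sb.D, fun _ he => sb.agree_off_touch he, hz, Or.inl ⟨sb.att_nonempty hX, sb.att_subset hX⟩⟩⟩

/-- A direct gluing of the `C`-cluster to `Ā` with a small cleared set is a gadget.
[cite: NewmanTassionWu2017, §3.2 (proof of Theorem 3.7)] -/
theorem of_directGlue_A (hX : ω ∈ Q.evX k) (dg : DirectGlue k Q.R Q.C Q.A ω)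
    (hz : ∃ z : ℤ × ℤ, dg.D ⊆ sqBox z r) : GadgetSpec Q k r ω dg.newConfig :=
  ⟨dg.newConfig_mem hX.2, fun _ he => dg.mem_window he,
    ⟨dg.D, fun _ he => dg.agree_off_touch he, hz,
      Or.inr (Or.inl ⟨dg.attT_nonempty hX.2, dg.attT_subset hX.2⟩)⟩⟩

/-- A direct gluing of the `A`-cluster to `C̄` with a small cleared set is a gadget.
[cite: NewmanTassionWu2017, §3.2 (proof of Theorem 3.7)] -/
theorem of_directGlue_C (hX : ω ∈ Q.evX k) (dg : DirectGlue k Q.R Q.A Q.C ω)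
    (hz : ∃ z : ℤ × ℤ, dg.D ⊆ sqBox z r) : GadgetSpec Q k r ω dg.newConfig :=
  have hnAC : ω ∉ slabConn k Q.R Q.A Q.C := fun h => hX.2 (slabConn_comm h)
  ⟨slabConn_comm (dg.newConfig_mem hnAC), fun _ he => dg.mem_window he,
    ⟨dg.D, fun _ he => dg.agree_off_touch he, hz,
      Or.inr (Or.inr ⟨dg.attT_nonempty hnAC, dg.attT_subset hnAC⟩)⟩⟩

end GadgetSpec

/-! ## The linear bound from gadgets -/

section Bound

variable {Q : GlueData} {ρ r : ℕ}

/-- **NTW 2017, proof of Thm. 3.7, second part, abstract form: `P[𝒳] ≤ λ^s · P[C ⟷^R A]`** as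
soon as every lattice configuration of `𝒳` admits a local modification in the sense of
`GadgetSpec` with box radius `r`; `λ = 2/min{p,1-p}`, `s = 3(5k+4)(4r+1)²` (Lemma 3.5 =
`lemma7_bond` with `t = 1`; the window of an image is the union of three boxes of radius `2r`
around chosen points of the three statistics). [cite: NewmanTassionWu2017, §3.2 (proof of Theorem 3.7, second part, P[𝒳] ≤ C₃ P[𝒳′])] -/
theorem real_evXn_le_of_gadgets (p : unitInterval) (hp0 : 0 < (p : ℝ)) (hp1 : (p : ℝ) < 1)
    (hgad : ∀ ω : BondConfig (slab 3 k), ω ⊆ (slabGraph 3 k).edgeSet → ω ∈ Q.evXn k ρ →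
      ∃ ω', GadgetSpec Q k r ω ω') :
    (bondPercolation (slabGraph 3 k) p).real (Q.evXn k ρ) ≤
      (2 / min (p : ℝ) (1 - p)) ^ (3 * ((5 * k + 4) * (2 * (2 * r) + 1) ^ 2)) *
        (bondPercolation (slabGraph 3 k) p).real (Q.evCA k) := by
  classical
  set P := bondPercolation (slabGraph 3 k) p with hP
  -- the chosen gadget
  let gad : ∀ ω : BondConfig (slab 3 k), ω ⊆ (slabGraph 3 k).edgeSet ∧ ω ∈ Q.evXn k ρ →
      BondConfig (slab 3 k) := fun ω h => Classical.choose (hgad ω h.1 h.2)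
  have hgad' : ∀ ω (h : ω ⊆ (slabGraph 3 k).edgeSet ∧ ω ∈ Q.evXn k ρ), GadgetSpec Q k r ω (gad ω h) :=
    fun ω h => Classical.choose_spec (hgad ω h.1 h.2)
  -- the window
  have hRfin : (slabLift k Q.R).Finite := slabLift_finite k Q.hRfin
  set K' : Finset (Sym2 (slab 3 k)) := (finite_sym2 hRfin).toFinset with hK'def
  have hK'coe : (↑K' : Set (Sym2 (slab 3 k))) = (slabLift k Q.R).sym2 := Set.Finite.coe_toFinset _
  set Kfin : Finset (Sym2 (slab 3 k)) := K'.filter (· ∈ (slabGraph 3 k).edgeSet) with hKfin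
  have hK : ∀ e, e ∈ Kfin ↔ e ∈ K' ∧ e ∈ (slabGraph 3 k).edgeSet := fun e => Finset.mem_filter
  have hKE : ∀ e ∈ Kfin, e ∈ (slabGraph 3 k).edgeSet := fun e he => ((hK e).1 he).2
  have hagree : ∀ ω ω' : BondConfig (slab 3 k), ω ∩ ↑K' = ω' ∩ ↑K' →
      ∀ e ∈ (slabLift k Q.R).sym2, e ∈ ω ↔ e ∈ ω' := by
    intro ω ω' heq e he
    rw [← hK'coe] at he
    have := Set.ext_iff.1 heq e
    simp only [Set.mem_inter_iff, he, and_true] at this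
    exact this
  have hA : DeterminedBy (Q.evXn k ρ) ↑K' := by
    rw [determinedBy_iff]
    intro ω ω' heq
    exact GlueData.mem_evXn_congr (hagree ω ω' heq)
  have hB : DeterminedBy (Q.evCA k) ↑K' := by
    rw [determinedBy_iff]
    intro ω ω' heq
    exact mem_slabConn_congr' (hagree ω ω' heq) subset_rfl
  -- lattice configurations inside the window
  have hlat : ∀ S : Finset (Sym2 (slab 3 k)), S ⊆ Kfin →
      (↑S : Set (Sym2 (slab 3 k))) ⊆ (slabGraph 3 k).edgeSet := fun S hS e he => hKE e (hS he)
  have hnewK : ∀ (S : Finset (Sym2 (slab 3 k))) (hS : S ⊆ Kfin) (hSX : (↑S : BondConfig (slab 3 k)) ∈ Q.evXn k ρ),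
      gad ↑S ⟨hlat S hS, hSX⟩ ⊆ ↑Kfin := by
    intro S hS hSX e he
    rcases (hgad' (↑S) ⟨hlat S hS, hSX⟩).window e he with h | ⟨h1, h2⟩
    · exact hS h
    · rw [Finset.mem_coe, hK]
      exact ⟨by rw [← Finset.mem_coe, hK'coe]; exact h2, h1⟩
  have hcoe : ∀ (S : Finset (Sym2 (slab 3 k))) (hS : S ⊆ Kfin) (hSX : (↑S : BondConfig (slab 3 k)) ∈ Q.evXn k ρ),
      (↑(Kfin.filter (· ∈ gad ↑S ⟨hlat S hS, hSX⟩)) : Set (Sym2 (slab 3 k))) =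
        gad ↑S ⟨hlat S hS, hSX⟩ := by
    intro S hS hSX
    ext e
    simp only [Finset.coe_filter, Set.mem_setOf_eq, and_iff_right_iff_imp]
    exact fun he => hnewK S hS hSX he
  -- the (single-valued) map
  set Φ : Finset (Sym2 (slab 3 k)) → Finset (Finset (Sym2 (slab 3 k))) := fun S =>
    if h : (↑S : Set (Sym2 (slab 3 k))) ⊆ (slabGraph 3 k).edgeSet ∧ (↑S : BondConfig (slab 3 k)) ∈ Q.evXn k ρ
    then {Kfin.filter (· ∈ gad ↑S h)} else ∅ with hΦ
  have hΦ_of : ∀ (S : Finset (Sym2 (slab 3 k)))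
      (h : (↑S : Set (Sym2 (slab 3 k))) ⊆ (slabGraph 3 k).edgeSet ∧ (↑S : BondConfig (slab 3 k)) ∈ Q.evXn k ρ),
      Φ S = {Kfin.filter (· ∈ gad ↑S h)} := fun S h => dif_pos h
  set lam : ℝ := 2 / min (p : ℝ) (1 - p) with hlam
  set s₀ : ℕ := (5 * k + 4) * (2 * (2 * r) + 1) ^ 2 with hs₀
  set s : ℕ := 3 * s₀ with hs
  -- the window around a vertex
  let box : slab 3 k → Finset (Sym2 (slab 3 k)) := fun q₀ =>
    Kfin.filter fun e => ∃ u ∈ e, planar k u ∈ (sqBox_finite (planar k q₀) (2 * r)).toFinset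
  have hbox_card : ∀ q₀, (box q₀).card ≤ s₀ := by
    intro q₀
    refine (card_filter_colEdges_le k Kfin hKE _).trans ?_
    have := card_toFinset_sqBox_le (planar k q₀) (2 * r)
    rw [hs₀]; exact Nat.mul_le_mul_left _ this
  -- agreement off the window, for a cleared set inside the box
  have hbox_agree : ∀ (S S' : Finset (Sym2 (slab 3 k))) (D : Set (ℤ × ℤ)) (q₀ : slab 3 k),
      S ⊆ Kfin → S' ⊆ Kfin → planar k q₀ ∈ D → (∃ z : ℤ × ℤ, D ⊆ sqBox z r) →
      (∀ e, e ∉ touch k D → (e ∈ (↑S : BondConfig (slab 3 k)) ↔ e ∈ (↑S' : BondConfig (slab 3 k)))) →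
      ∀ e, e ∉ box q₀ → (e ∈ S ↔ e ∈ S') := by
    intro S S' D q₀ hS hS' hq₀D hz hag e heT
    obtain ⟨z, hDz⟩ := hz
    have hDq : D ⊆ sqBox (planar k q₀) (2 * r) := hDz.trans (sqBox_subset_double (hDz hq₀D))
    by_cases heK : e ∈ Kfin
    · have hnt : e ∉ touch k D := by
        rintro ⟨x, hx, hxD⟩
        exact heT (Finset.mem_filter.2 ⟨heK, x, hx, (Set.Finite.mem_toFinset _).2 (hDq hxD)⟩)
      have := hag e hnt
      simp only [Finset.mem_coe] at this
      exact this
    · constructor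
      · intro heS; exact absurd (hS heS) heK
      · intro heS'; exact absurd (hS' heS') heK
  have hmain := lemma7_bond (slabGraph 3 k) p hp0 hp1 K' Kfin hK hA hB s zero_lt_one Φ ?_ ?_ ?_
  · calc P.real (Q.evXn k ρ) ≤ lam ^ s / 1 * P.real (Q.evCA k) := hmain
      _ = lam ^ s * P.real (Q.evCA k) := by rw [div_one]
  · -- the image glues `C` to `A`
    intro S hS hSA S' hS'
    have h : (↑S : Set (Sym2 (slab 3 k))) ⊆ (slabGraph 3 k).edgeSet ∧ (↑S : BondConfig (slab 3 k)) ∈ Q.evXn k ρ :=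
      ⟨hlat S hS, hSA⟩
    rw [hΦ_of S h, Finset.mem_singleton] at hS'
    subst hS'
    refine ⟨Finset.filter_subset _ _, ?_⟩
    rw [hcoe S hS hSA]
    exact (hgad' (↑S) h).mem
  · -- one image
    intro S hS hSA
    have h : (↑S : Set (Sym2 (slab 3 k))) ⊆ (slabGraph 3 k).edgeSet ∧ (↑S : BondConfig (slab 3 k)) ∈ Q.evXn k ρ :=
      ⟨hlat S hS, hSA⟩
    rw [hΦ_of S h]
    simp
  · -- recovery window
    intro S' hS' _
    set ω' : BondConfig (slab 3 k) := ↑S' with hω'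
    set T₁ : Finset (Sym2 (slab 3 k)) :=
      if h : (Q.att k ω').Nonempty then box h.some else ∅ with hT₁
    set T₂ : Finset (Sym2 (slab 3 k)) :=
      if h : (attT k Q.R Q.C Q.A ω').Nonempty then box h.some else ∅ with hT₂
    set T₃ : Finset (Sym2 (slab 3 k)) :=
      if h : (attT k Q.R Q.A Q.C ω').Nonempty then box h.some else ∅ with hT₃
    have hT₁c : T₁.card ≤ s₀ := by rw [hT₁]; split_ifs <;> simp [hbox_card]
    have hT₂c : T₂.card ≤ s₀ := by rw [hT₂]; split_ifs <;> simp [hbox_card]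
    have hT₃c : T₃.card ≤ s₀ := by rw [hT₃]; split_ifs <;> simp [hbox_card]
    refine ⟨T₁ ∪ T₂ ∪ T₃, ?_, ?_⟩
    · calc (T₁ ∪ T₂ ∪ T₃).card ≤ (T₁ ∪ T₂).card + T₃.card := Finset.card_union_le _ _
        _ ≤ (T₁.card + T₂.card) + T₃.card := by gcongr; exact Finset.card_union_le _ _
        _ ≤ s₀ + s₀ + s₀ := by omega
        _ = s := by rw [hs]; ring
    · intro S hS hSA hmem e heT
      have h : (↑S : Set (Sym2 (slab 3 k))) ⊆ (slabGraph 3 k).edgeSet ∧ (↑S : BondConfig (slab 3 k)) ∈ Q.evXn k ρ :=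
        ⟨hlat S hS, hSA⟩
      rw [hΦ_of S h, Finset.mem_singleton] at hmem
      have hω'eq : ω' = gad ↑S h := by rw [hω', hmem, hcoe S hS hSA]
      simp only [Finset.mem_union, not_or] at heT
      obtain ⟨⟨heT₁, heT₂⟩, heT₃⟩ := heT
      obtain ⟨D, hag, hz, hstat⟩ := (hgad' ↑S h).recover
      have hag' : ∀ e', e' ∉ touch k D →
          (e' ∈ (↑S : BondConfig (slab 3 k)) ↔ e' ∈ (↑S' : BondConfig (slab 3 k))) := by
        intro e' he'
        rw [show ((↑S' : BondConfig (slab 3 k))) = gad ↑S h from hω' ▸ hω'eq]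
        exact hag e' he'
      rcases hstat with ⟨hne, hsub⟩ | ⟨hne, hsub⟩ | ⟨hne, hsub⟩
      · rw [← hω'eq] at hne hsub
        have hT₁' : T₁ = box hne.some := by rw [hT₁, dif_pos hne]
        have hq₀D : planar k hne.some ∈ D := by
          have := hsub hne.some_mem; rwa [mem_slabLift_iff] at this
        exact hbox_agree S S' D hne.some hS hS' hq₀D hz hag' e (hT₁' ▸ heT₁)
      · rw [← hω'eq] at hne hsub
        have hT₂' : T₂ = box hne.some := by rw [hT₂, dif_pos hne]
        have hq₀D : planar k hne.some ∈ D := by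
          have := hsub hne.some_mem; rwa [mem_slabLift_iff] at this
        exact hbox_agree S S' D hne.some hS hS' hq₀D hz hag' e (hT₂' ▸ heT₂)
      · rw [← hω'eq] at hne hsub
        have hT₃' : T₃ = box hne.some := by rw [hT₃, dif_pos hne]
        have hq₀D : planar k hne.some ∈ D := by
          have := hsub hne.some_mem; rwa [mem_slabLift_iff] at this
        exact hbox_agree S S' D hne.some hS hS' hq₀D hz hag' e (hT₃' ▸ heT₃)

/-- **Thm. 3.7 in the linear regime, abstract form**: `P_p[A ⟷ B, C̄ ⟷^{R̄} 𝒩(Γ̄, ρ)] ≤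
(1 + λ^s) · P_p[C ⟷^R A]` as soon as gadgets exist on `𝒳`.
[cite: NewmanTassionWu2017, §3.2 (Theorem 3.7 with Remark 3, h₀(x) ≥ c₀ x)] -/
theorem real_evAB_inter_evNear_le_of_gadgets (p : unitInterval) (hp0 : 0 < (p : ℝ))
    (hp1 : (p : ℝ) < 1)
    (hgad : ∀ ω : BondConfig (slab 3 k), ω ⊆ (slabGraph 3 k).edgeSet → ω ∈ Q.evXn k ρ →
      ∃ ω', GadgetSpec Q k r ω ω') :
    (bondPercolation (slabGraph 3 k) p).real (Q.evAB k ∩ Q.evNear k ρ) ≤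
      (1 + (2 / min (p : ℝ) (1 - p)) ^ (3 * ((5 * k + 4) * (2 * (2 * r) + 1) ^ 2))) *
        (bondPercolation (slabGraph 3 k) p).real (Q.evCA k) := by
  set P := bondPercolation (slabGraph 3 k) p with hP
  have hsub : Q.evAB k ∩ Q.evNear k ρ ⊆ Q.evXn k ρ ∪ Q.evCA k := by
    intro ω ⟨hAB, hN⟩
    by_cases hCA : ω ∈ Q.evCA k
    · exact Or.inr hCA
    · exact Or.inl ⟨⟨hAB, hCA⟩, hN⟩
  have h1 := real_evXn_le_of_gadgets p hp0 hp1 hgad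
  calc P.real (Q.evAB k ∩ Q.evNear k ρ) ≤ P.real (Q.evXn k ρ ∪ Q.evCA k) :=
        measureReal_mono hsub
    _ ≤ P.real (Q.evXn k ρ) + P.real (Q.evCA k) := measureReal_union_le _ _
    _ ≤ _ := by rw [add_mul, one_mul, add_comm]; gcongr

/-- Under the planar-crossing hypothesis in `S`, `A ⟷^S B` and `C ⟷^S D` force a contact at
distance `0` (lattice configurations), for any gluing data with that `S`.
[cite: NewmanTassionWu2017, §3.2 (proof of Theorem 3.6, "{A ↔ B, C ↔ D} implies {C ↔ Γ̄}")] -/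
theorem GlueData.mem_evNear_of_cross {Dd : Set (ℤ × ℤ)} (hcross : PlanarCrossing Q.S Q.A Q.B Q.C Dd)
    {ω : BondConfig (slab 3 k)} (hω : ω ⊆ (slabGraph 3 k).edgeSet) (hAB : ω ∈ Q.evAB k)
    (hCD : ω ∈ slabConn k Q.S Q.C Dd) : ω ∈ Q.evNear k ρ := by
  obtain ⟨hγO, -⟩ := Q.γ_spec hAB
  obtain ⟨L, hL⟩ := (mem_slabConn_iff_exists_isOSAP ω _ _ _).1 hCD
  set γ := Q.γ k ω with hγdef
  have hw₁ := isPlanarWalk_map_planar hω hγO.chain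
  have hw₂ := isPlanarWalk_map_planar hω hL.chain
  have hne₁ : γ.map (planar k) ≠ [] := by simpa using hγO.ne_nil
  have hne₂ : L.map (planar k) ≠ [] := by simpa using hL.ne_nil
  have hhead₁ : (γ.map (planar k)).head hne₁ ∈ Q.A := by
    rw [List.head_map]; exact hγO.head_mem hγO.ne_nil
  have hlast₁ : (γ.map (planar k)).getLast hne₁ ∈ Q.B := by
    rw [List.getLast_map]; exact hγO.last_mem hγO.ne_nil
  have hhead₂ : (L.map (planar k)).head hne₂ ∈ Q.C := by
    rw [List.head_map]; exact hL.head_mem hL.ne_nil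
  have hlast₂ : (L.map (planar k)).getLast hne₂ ∈ Dd := by
    rw [List.getLast_map]; exact hL.last_mem hL.ne_nil
  obtain ⟨z, hz₁, hz₂⟩ := hcross _ _ hne₁ hne₂ hw₁ hw₂
    (fun z hz => by obtain ⟨g, hg, rfl⟩ := List.mem_map.1 hz; exact hγO.subset g hg)
    (fun z hz => by obtain ⟨x, hx, rfl⟩ := List.mem_map.1 hz; exact hL.subset x hx)
    hhead₁ hlast₁ hhead₂ hlast₂
  obtain ⟨g, hg, hgz⟩ := List.mem_map.1 hz₁
  obtain ⟨x, hx, hxz⟩ := List.mem_map.1 hz₂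
  refine ⟨L.head hL.ne_nil, hL.head_mem hL.ne_nil, x,
    openConnIn_mono (slabLift_mono k Q.hSR) _ _ (hL.openConnIn_of_mem hx), g, hg, ?_⟩
  rw [hxz, ← hgz]
  exact sqBox_mono _ (Nat.zero_le ρ) (mem_sqBox_self _ _)

/-- **Thm. 3.6 (GL0) in the linear regime, abstract form, `R = S`**: under the planar-crossing
hypothesis for `(A, B, C, D)`, if gadgets exist on `𝒳`, then
`P_p[A ⟷^S B] · P_p[C ⟷^S D] ≤ (1 + λ^s) · P_p[C ⟷^S A]` (Harris–FKG).
[cite: NewmanTassionWu2017, §3.2 (Theorem 3.6 with Remark 3: h₀(x) ≥ c₀ x)] -/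
theorem glueLinear_of_gadgets (hRS : Q.R = Q.S) {Dd : Set (ℤ × ℤ)}
    (hcross : PlanarCrossing Q.S Q.A Q.B Q.C Dd)
    (p : unitInterval) (hp0 : 0 < (p : ℝ)) (hp1 : (p : ℝ) < 1)
    (hgad : ∀ ω : BondConfig (slab 3 k), ω ⊆ (slabGraph 3 k).edgeSet → ω ∈ Q.evXn k ρ →
      ∃ ω', GadgetSpec Q k r ω ω') :
    (bondPercolation (slabGraph 3 k) p).real (slabConn k Q.S Q.A Q.B) *
        (bondPercolation (slabGraph 3 k) p).real (slabConn k Q.S Q.C Dd) ≤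
      (1 + (2 / min (p : ℝ) (1 - p)) ^ (3 * ((5 * k + 4) * (2 * (2 * r) + 1) ^ 2))) *
        (bondPercolation (slabGraph 3 k) p).real (slabConn k Q.S Q.C Q.A) := by
  set P := bondPercolation (slabGraph 3 k) p with hP
  have hfin : (slabLift k Q.S).sym2.Finite := finite_sym2 Q.S_finite
  have hloc : ∀ X Y : Set (ℤ × ℤ), IsLocalEvent (slabConn k Q.S X Y) := by
    intro X Y
    refine ⟨hfin.toFinset, ?_⟩
    rw [Set.Finite.coe_toFinset]
    exact determinedBy_slabConn k X Y subset_rfl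
  have hH : P.real (slabConn k Q.S Q.A Q.B) * P.real (slabConn k Q.S Q.C Dd) ≤
      P.real (slabConn k Q.S Q.A Q.B ∩ slabConn k Q.S Q.C Dd) :=
    harris_fkg_local (slabGraph 3 k) p (isUpperSet_openCrossing _ _ _) (isUpperSet_openCrossing _ _ _)
      (hloc _ _) (hloc _ _)
  have hae : ∀ᵐ ω ∂P, ω ∈ slabConn k Q.S Q.A Q.B ∩ slabConn k Q.S Q.C Dd →
      ω ∈ Q.evAB k ∩ Q.evNear k ρ := by
    filter_upwards [ae_subset_edgeSet (slabGraph 3 k) p] with ω hω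
    rintro ⟨hAB, hCD⟩
    exact ⟨hAB, Q.mem_evNear_of_cross hcross hω hAB hCD⟩
  have hmono : P.real (slabConn k Q.S Q.A Q.B ∩ slabConn k Q.S Q.C Dd) ≤
      P.real (Q.evAB k ∩ Q.evNear k ρ) := by
    simp only [measureReal_def]
    exact ENNReal.toReal_mono (measure_ne_top _ _) (measure_mono_ae hae)
  have h := real_evAB_inter_evNear_le_of_gadgets (Q := Q) (ρ := ρ) p hp0 hp1 hgad
  have hCA : Q.evCA k = slabConn k Q.S Q.C Q.A := by
    show slabConn k Q.R Q.C Q.A = _; rw [hRS]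
  rw [hCA] at h
  exact hH.trans (hmono.trans h)

end Bound

end NTW17

end Literature.Probability.Percolation
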